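import Mathlib
import Summits.NavierStokesRegularity.NavierStokesRegularity.Theorems.EulerZoomLiouvillePowerGaugeEulerLiouvilleAnchoredBudgetStarvation
import Summits.NavierStokesRegularity.NavierStokesRegularity.Theorems.EulerZoomLiouvillePowerGaugeEulerLiouvilleAnchoredBudgetFloor
import Summits.NavierStokesRegularity.NavierStokesRegularity.Theorems.EulerZoomLiouvillePowerGaugeEulerLiouvillePastIrrotational
import Summits.NavierStokesRegularity.NavierStokesRegularity.Theorems.EulerZoomLiouvillePowerGaugeEulerLiouvilleLargeRho
import HarnessLib

/-!
# Crux `EulerZoomLiouville.PowerGaugeEulerLiouville` (stmt-NavierStokesRegularity-19832), line `anchored-budget`: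
# THE STRATUM `IsAnchoredBudgeted` CLOSES BY NAME (C1 ∘ C2 ∘ the lead's `PastIrrotational`)

Route `EulerZoomLiouville` (NavierStokesRegularity), crux E.  Line `anchored-budget` (ideator ns-idea-11 g4;
`Cruxes/PowerGaugeEulerLiouville/Lines/anchored_budget.lean`).  The line's composition (`anchoredBudget_K0_of`, the stratum branch of
`PowerGaugeEulerLiouville_of`) is re-run on the LANDED fillers:

* C1 (rev2, WITH the flow-owning clause «gradient bounded on compact time sets, uniformly in `x`»): `AnchoredBudget.anchoredFloorTransport`
  (ns-sfl-p1 g3, `…AnchoredBudgetFloor`);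
* C2 (rev3 binders — clause-free `IsAnchorablePast`, so it serves BOTH revisions): `AnchoredBudget.anchoredStarvation` (this seat, `…AnchoredBudgetStarvation`);
* the irrotational-past filler `PastIrrotational.ae_eq_zero_of_gauge_of_pastIrrotational` and `powerGaugeEulerLiouville_largeRho` (LEAD ns-typeII-p2).

Results:
* `anchoredBudgeted_ae_eq_zero` — UNCONDITIONAL, the rev2 stratum: for every `ρ > 0`, a member of the power-gauged class with a CLASSICAL far past `(−∞,T₁)`
  carrying the flow-owning clause and a stretching budget `(K, Λ)`, `0 ≤ K < ρ/(1+ρ)`, vanishes a.e.;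
* `anchoredBudgeted_K0_ae_eq_zero` — its quotable `K = 0` member (critic V37 P2): `|ω| e^{−∫Λ}` non-increasing forward along the far past ⇒ trivial;
* `anchoredBudgeted_ae_eq_zero_of_floorTransport` — the rev3 (clause-free) stratum CONDITIONAL on the rev3 C1 `Sig.stub_anchoredFloorTransport`
  (δ-unfolded hypothesis; open, next task on the line), by the same composition.

WHAT THIS IS NOT: not NS regularity, not the crux E — stratum lemmas `--supports` stmt-19832 about a hypothetical Euler zoom-limit class (MODEL lattice);
the residue C3 `stub_anchoredRest`, the rev3 C1, crux 19832 and NS regularity stay OPEN; nothing is wired into the lead's skeleton by this seat.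
[cite: CrippaDeLellis2008, §2–3; CaffarelliKohnNirenberg1982, §2; MajdaBertozziCUP2002, §1.6]
-/

noncomputable section

set_option linter.dupNamespace false

open MeasureTheory Set Filter Topology Metric Function
open scoped NNReal ENNReal RealInnerProductSpace

namespace Summit.NavierStokesRegularity.NavierStokesRegularity.Theorems.PowerGaugeEulerLiouville.AnchoredBudget

open Literature.Analysis Literature.Analysis.FluidPDE
open Summit.NavierStokesRegularity.NavierStokesRegularity.Theorems.PowerGaugeEulerLiouville (powerGaugeEulerLiouville_largeRho)
open Summit.NavierStokesRegularity.NavierStokesRegularity.Theorems.PowerGaugeEulerLiouville.PastIrrotational (ae_eq_zero_of_gauge_of_pastIrrotational)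

/-- **THE rev2 STRATUM `IsAnchoredBudgeted` IS TRIVIAL (unconditional).**  For every `ρ > 0`: a member of Seregin's power-gauged ancient Euler class whose far
past `(−∞,T₁)` (`T₁ ≤ 0`) is CLASSICAL with the flow-owning clause (gradient bounded on compact time sets, uniformly in space) and carries a stretching budget
`⟪∇u ω, ω⟫ ≤ (K/(−τ) + Λ(τ))|ω|²`, `Λ ≥ 0` integrable, `0 ≤ K < ρ/(1+ρ)`, vanishes a.e. on the past slab.  (`ρ > 1/2`: `powerGaugeEulerLiouville_largeRho`;
`ρ ≤ 1/2`: C1 `anchoredFloorTransport` ∘ C2 `anchoredStarvation` ∘ `PastIrrotational.ae_eq_zero_of_gauge_of_pastIrrotational`.)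
[cite: CrippaDeLellis2008, §2–3; CaffarelliKohnNirenberg1982, §2] -/
theorem anchoredBudgeted_ae_eq_zero :
    ∀ ρ : ℝ, 0 < ρ → ∀ (u : ℝ → EuclideanSpace ℝ (Fin 3) → EuclideanSpace ℝ (Fin 3))
      (p : ℝ → EuclideanSpace ℝ (Fin 3) → ℝ)
      (H : ℝ → EuclideanSpace ℝ (Fin 3) → EuclideanSpace ℝ (Fin 3) →L[ℝ] EuclideanSpace ℝ (Fin 3)) (c : ℝ≥0),
      (IsSuitableWeakSolutionOn (slab (EuclideanSpace ℝ (Fin 3)) (Set.Iio 0) isOpen_Iio) 0 0 u p ∧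
        HasWeakSpatialGradientOn (slab (EuclideanSpace ℝ (Fin 3)) (Set.Iio 0) isOpen_Iio) u H ∧
        (∀ a : ℝ, 0 < a →
          ENNReal.ofReal (a ^ (2 * ρ)) * cknA a (0 : ℝ × EuclideanSpace ℝ (Fin 3)) u +
              ENNReal.ofReal (a ^ ρ) * cknE a (0 : ℝ × EuclideanSpace ℝ (Fin 3)) H +
            ENNReal.ofReal (a ^ (2 * ρ)) * cknD a (0 : ℝ × EuclideanSpace ℝ (Fin 3)) p ≤ (c : ℝ≥0∞))) →
      (∃ (T₁ K : ℝ) (Λ : ℝ → ℝ),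
        (IsClassicalEulerSolutionOn (Set.Iio 0) 0 u p ∧ T₁ ≤ 0 ∧
          (∀ t₁ t₂ : ℝ, t₁ < t₂ → t₂ < 0 → ∃ L : ℝ, ∀ τ ∈ Set.Icc t₁ t₂, ∀ x : EuclideanSpace ℝ (Fin 3),
            ‖fderiv ℝ (u τ) x‖ ≤ L)) ∧
        0 ≤ K ∧ K < ρ / (1 + ρ) ∧
        (IntegrableOn Λ (Set.Iio T₁) ∧ (∀ τ : ℝ, 0 ≤ Λ τ) ∧
          ∀ τ : ℝ, τ < T₁ → ∀ x : EuclideanSpace ℝ (Fin 3),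
            ⟪fderiv ℝ (u τ) x (curl (u τ) x), curl (u τ) x⟫ ≤ (K / (-τ) + Λ τ) * ‖curl (u τ) x‖ ^ 2)) →
      Function.uncurry u =ᵐ[volume.restrict (Set.Iio (0 : ℝ) ×ˢ (Set.univ : Set (EuclideanSpace ℝ (Fin 3))))] 0 := by
  intro ρ hρ u p H c hcls hS
  obtain ⟨hsw, hH, hc⟩ := hcls
  by_cases hhalf : 1 / 2 < ρ
  · exact powerGaugeEulerLiouville_largeRho ρ hhalf u p H c hsw hH hc
  · have hρ2 : ρ ≤ 1 / 2 := not_lt.mp hhalf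
    obtain ⟨T₁, K, Λ, hP, hK0, hK, hB⟩ := hS
    have hblobs := anchoredFloorTransport u p T₁ K Λ hP hK0 hB
    have hcurl : ∀ τ : ℝ, τ < T₁ → ∀ x : EuclideanSpace ℝ (Fin 3), curl (u τ) x = 0 :=
      anchoredStarvation ρ hρ hρ2 u p H c ⟨hsw, hH, hc⟩ T₁ K Λ ⟨hP.1, hP.2.1⟩ hK0 hK hB hblobs
    have hcl : IsClassicalEulerSolutionOn (Set.Iio 0) 0 u p := hP.1
    have hT₁ : T₁ ≤ 0 := hP.2.1
    have hmem : ∀ τ : ℝ, τ < T₁ → τ ∈ Set.Iio (0 : ℝ) := fun τ hτ => lt_of_lt_of_le hτ hT₁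
    exact ae_eq_zero_of_gauge_of_pastIrrotational hρ hρ2 hsw hH hc hT₁
      (fun τ hτ => (hcl.contDiff_velocity (hmem τ hτ)).of_le (by norm_cast)) (fun τ hτ => hcl.divFree τ (hmem τ hτ)) hcurl

/-- **THE QUOTABLE `K = 0` MEMBER (critic V37 P2), unconditional:** for every `ρ > 0`, a member of the power-gauged class with a classical, flow-owning far past
`(−∞,T₁)` along which `⟪∇u ω, ω⟫ ≤ Λ(τ)|ω|²` with `Λ ≥ 0` integrable (so `|ω| e^{−∫Λ}` is non-increasing forward on every trajectory) vanishes a.e.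
[cite: CrippaDeLellis2008, §2–3] -/
theorem anchoredBudgeted_K0_ae_eq_zero :
    ∀ ρ : ℝ, 0 < ρ → ∀ (u : ℝ → EuclideanSpace ℝ (Fin 3) → EuclideanSpace ℝ (Fin 3))
      (p : ℝ → EuclideanSpace ℝ (Fin 3) → ℝ)
      (H : ℝ → EuclideanSpace ℝ (Fin 3) → EuclideanSpace ℝ (Fin 3) →L[ℝ] EuclideanSpace ℝ (Fin 3)) (c : ℝ≥0),
      (IsSuitableWeakSolutionOn (slab (EuclideanSpace ℝ (Fin 3)) (Set.Iio 0) isOpen_Iio) 0 0 u p ∧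
        HasWeakSpatialGradientOn (slab (EuclideanSpace ℝ (Fin 3)) (Set.Iio 0) isOpen_Iio) u H ∧
        (∀ a : ℝ, 0 < a →
          ENNReal.ofReal (a ^ (2 * ρ)) * cknA a (0 : ℝ × EuclideanSpace ℝ (Fin 3)) u +
              ENNReal.ofReal (a ^ ρ) * cknE a (0 : ℝ × EuclideanSpace ℝ (Fin 3)) H +
            ENNReal.ofReal (a ^ (2 * ρ)) * cknD a (0 : ℝ × EuclideanSpace ℝ (Fin 3)) p ≤ (c : ℝ≥0∞))) →
      ∀ (T₁ : ℝ) (Λ : ℝ → ℝ),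
        (IsClassicalEulerSolutionOn (Set.Iio 0) 0 u p ∧ T₁ ≤ 0 ∧
          (∀ t₁ t₂ : ℝ, t₁ < t₂ → t₂ < 0 → ∃ L : ℝ, ∀ τ ∈ Set.Icc t₁ t₂, ∀ x : EuclideanSpace ℝ (Fin 3),
            ‖fderiv ℝ (u τ) x‖ ≤ L)) →
        IntegrableOn Λ (Set.Iio T₁) → (∀ τ : ℝ, 0 ≤ Λ τ) →
        (∀ τ : ℝ, τ < T₁ → ∀ x : EuclideanSpace ℝ (Fin 3),
          ⟪fderiv ℝ (u τ) x (curl (u τ) x), curl (u τ) x⟫ ≤ Λ τ * ‖curl (u τ) x‖ ^ 2) →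
        Function.uncurry u =ᵐ[volume.restrict (Set.Iio (0 : ℝ) ×ˢ (Set.univ : Set (EuclideanSpace ℝ (Fin 3))))] 0 := by
  intro ρ hρ u p H c hcls T₁ Λ hP hΛi hΛ0 hbud
  have hthr : (0 : ℝ) < ρ / (1 + ρ) := div_pos hρ (by linarith)
  refine anchoredBudgeted_ae_eq_zero ρ hρ u p H c hcls ⟨T₁, 0, Λ, hP, le_rfl, hthr, hΛi, hΛ0, fun τ hτ x => ?_⟩
  rw [zero_div, zero_add]
  exact hbud τ hτ x

/-- **THE rev3 (clause-free) STRATUM, CONDITIONAL on the rev3 C1.**  If anchored floor transport holds for EVERY classical far past (the clause-free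
`Sig.stub_anchoredFloorTransport` of the current line file, δ-unfolded — OPEN), then for every `ρ > 0` a member of the power-gauged class with a classical far
past carrying a stretching budget `(K, Λ)`, `0 ≤ K < ρ/(1+ρ)`, vanishes a.e. — NO velocity envelope, NO flow clause.  (Same composition; C2 is clause-free.)
[cite: CrippaDeLellis2008, §2–3; CaffarelliKohnNirenberg1982, §2] -/
theorem anchoredBudgeted_ae_eq_zero_of_floorTransport
    (hC1 : ∀ (u : ℝ → EuclideanSpace ℝ (Fin 3) → EuclideanSpace ℝ (Fin 3)) (p : ℝ → EuclideanSpace ℝ (Fin 3) → ℝ) (T₁ K : ℝ)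
      (Λ : ℝ → ℝ), (IsClassicalEulerSolutionOn (Set.Iio 0) 0 u p ∧ T₁ ≤ 0) → 0 ≤ K →
      (IntegrableOn Λ (Set.Iio T₁) ∧ (∀ τ : ℝ, 0 ≤ Λ τ) ∧
        ∀ τ : ℝ, τ < T₁ → ∀ x : EuclideanSpace ℝ (Fin 3),
          ⟪fderiv ℝ (u τ) x (curl (u τ) x), curl (u τ) x⟫ ≤ (K / (-τ) + Λ τ) * ‖curl (u τ) x‖ ^ 2) →
      ∀ t₀ : ℝ, t₀ < T₁ → ∀ (x₀ : EuclideanSpace ℝ (Fin 3)) (δ w a : ℝ) (Φ : ℝ → ℝ), 0 < δ → 0 ≤ w → 0 < a →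
        ‖x₀‖ + δ ≤ a / 2 → (∀ x ∈ ball x₀ δ, w ≤ ‖curl (u t₀) x‖) →
        ∀ t₁ : ℝ, t₁ < t₀ → IntegrableOn Φ (Set.Icc t₁ t₀) → (∀ s ∈ Set.Icc t₁ t₀, 0 ≤ Φ s) →
          (∀ s ∈ Set.Icc t₁ t₀, ∀ E : Set (EuclideanSpace ℝ (Fin 3)), MeasurableSet E →
            E ⊆ ball (0 : EuclideanSpace ℝ (Fin 3)) a → volume E ≤ volume (ball x₀ δ) →
              ∫⁻ x in E, ‖u s x‖ₑ ≤ ENNReal.ofReal (Φ s)) →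
          ∃ T : Set (EuclideanSpace ℝ (Fin 3)), MeasurableSet T ∧ T ⊆ ball (0 : EuclideanSpace ℝ (Fin 3)) a ∧
            volume (ball x₀ δ) ≤ volume T + ENNReal.ofReal ((∫ s in Set.Icc t₁ t₀, Φ s) / (a / 2)) ∧
            ∀ x ∈ T, w ^ 2 * Real.exp (-(2 * ∫ s in Set.Ioo t₁ t₀, Λ s)) * ((-t₀) / (-t₁)) ^ (2 * K) ≤
              ‖curl (u t₁) x‖ ^ 2) :
    ∀ ρ : ℝ, 0 < ρ → ∀ (u : ℝ → EuclideanSpace ℝ (Fin 3) → EuclideanSpace ℝ (Fin 3))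
      (p : ℝ → EuclideanSpace ℝ (Fin 3) → ℝ)
      (H : ℝ → EuclideanSpace ℝ (Fin 3) → EuclideanSpace ℝ (Fin 3) →L[ℝ] EuclideanSpace ℝ (Fin 3)) (c : ℝ≥0),
      (IsSuitableWeakSolutionOn (slab (EuclideanSpace ℝ (Fin 3)) (Set.Iio 0) isOpen_Iio) 0 0 u p ∧
        HasWeakSpatialGradientOn (slab (EuclideanSpace ℝ (Fin 3)) (Set.Iio 0) isOpen_Iio) u H ∧
        (∀ a : ℝ, 0 < a →
          ENNReal.ofReal (a ^ (2 * ρ)) * cknA a (0 : ℝ × EuclideanSpace ℝ (Fin 3)) u +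
              ENNReal.ofReal (a ^ ρ) * cknE a (0 : ℝ × EuclideanSpace ℝ (Fin 3)) H +
            ENNReal.ofReal (a ^ (2 * ρ)) * cknD a (0 : ℝ × EuclideanSpace ℝ (Fin 3)) p ≤ (c : ℝ≥0∞))) →
      (∃ (T₁ K : ℝ) (Λ : ℝ → ℝ),
        (IsClassicalEulerSolutionOn (Set.Iio 0) 0 u p ∧ T₁ ≤ 0) ∧ 0 ≤ K ∧ K < ρ / (1 + ρ) ∧
        (IntegrableOn Λ (Set.Iio T₁) ∧ (∀ τ : ℝ, 0 ≤ Λ τ) ∧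
          ∀ τ : ℝ, τ < T₁ → ∀ x : EuclideanSpace ℝ (Fin 3),
            ⟪fderiv ℝ (u τ) x (curl (u τ) x), curl (u τ) x⟫ ≤ (K / (-τ) + Λ τ) * ‖curl (u τ) x‖ ^ 2)) →
      Function.uncurry u =ᵐ[volume.restrict (Set.Iio (0 : ℝ) ×ˢ (Set.univ : Set (EuclideanSpace ℝ (Fin 3))))] 0 := by
  intro ρ hρ u p H c hcls hS
  obtain ⟨hsw, hH, hc⟩ := hcls
  by_cases hhalf : 1 / 2 < ρ
  · exact powerGaugeEulerLiouville_largeRho ρ hhalf u p H c hsw hH hc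
  · have hρ2 : ρ ≤ 1 / 2 := not_lt.mp hhalf
    obtain ⟨T₁, K, Λ, hP, hK0, hK, hB⟩ := hS
    have hcurl : ∀ τ : ℝ, τ < T₁ → ∀ x : EuclideanSpace ℝ (Fin 3), curl (u τ) x = 0 :=
      anchoredStarvation ρ hρ hρ2 u p H c ⟨hsw, hH, hc⟩ T₁ K Λ hP hK0 hK hB (hC1 u p T₁ K Λ hP hK0 hB)
    have hcl : IsClassicalEulerSolutionOn (Set.Iio 0) 0 u p := hP.1
    have hT₁ : T₁ ≤ 0 := hP.2
    have hmem : ∀ τ : ℝ, τ < T₁ → τ ∈ Set.Iio (0 : ℝ) := fun τ hτ => lt_of_lt_of_le hτ hT₁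
    exact ae_eq_zero_of_gauge_of_pastIrrotational hρ hρ2 hsw hH hc hT₁
      (fun τ hτ => (hcl.contDiff_velocity (hmem τ hτ)).of_le (by norm_cast)) (fun τ hτ => hcl.divFree τ (hmem τ hτ)) hcurl

end Summit.NavierStokesRegularity.NavierStokesRegularity.Theorems.PowerGaugeEulerLiouville.AnchoredBudget

end
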